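import Literature.MathematicalPhysics.KineticTheory.HardSphereDLRBoundary
import Mathlib.Analysis.SpecificLimits.Basic
import HarnessLib

/-!
# Uniqueness of the local Gibbs state of the hard-sphere gas at small activity

Topic `Literature/MathematicalPhysics/KineticTheory`; PROOFS (no definitions, no named facts): the
general-dimension port (`EuclideanSpace ℝ ι`, namespace `HardSphereDLR`) of the tree's
three-dimensional `RiemannLocalGibbsUniqueness.lean` (fourth file of the general-dimension port needed
for `HardSphereGibbsLowDensityUniqueness`; `ℝ³` in the comments stands for `ℝ^ι`); there: third file towards
`Literature.MathematicalPhysics.KineticTheory.RiemannLocalGibbsExistsUnique`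
(`RiemannLocalGibbsLaw.lean`).

* **Local events generate** (`generateFrom_localEvents`, `isPiSystem_localEvents`): the events
  `{c | c|_{B(0,k) × ℝ³} ∈ A'}`, `k ∈ ℕ`, `A'` measurable, form a π-system generating the count
  σ-algebra of `PointConfig Phase` (a count is the supremum of the counts inside the balls).
* **Uniqueness** (`IsHsLocalGibbs.unique_of_small_activity`; Michelen–Perkins 2021, Thm 3 /
  Thm 25 for the hard-sphere gas with an activity function, here with the crude threshold
  `2κ < 1`, `κ` the maximal intensity of a ball window): two solutions `μ, μ'` of the DLR
  equations `IsHsLocalGibbs σ ν` coincide.  By the DLR equation in the ball `B(0, R)`,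
  `μ(A) = ∫ γ_{B(0,R)}(η)(A) dμ(η)` is an average over `μ`-almost surely hard-core boundary
  conditions, and by the decay of the boundary influence (`abs_hsLocalSpec_toReal_sub_le`) every
  such `γ_{B(0,R)}(η)(A)` is within `C_k (2κ)^d` of the free value `γ_{B(0,R)}(∅)(A)` for a local
  event `A` in `B(0, k)`, `R = k + (d+2)σ`; hence `|μ(A) - μ'(A)| ≤ 2 C_k (2κ)^d → 0`.

## References

* M. Michelen, W. Perkins, *Potential-weighted connective constants and uniqueness of Gibbs
  measures*, arXiv:2109.01094, Thm 3, Thm 25, §5. [MichelenPerkins2021]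
* H.-O. Georgii, *Gibbs Measures and Phase Transitions* (2011), Def. 1.23, §4 (uniqueness via
  the DLR equations).
-/

noncomputable section

open MeasureTheory ProbabilityTheory Set Filter
open scoped ENNReal NNReal Topology

namespace Literature.MathematicalPhysics.KineticTheory

namespace HardSphereDLR

open Literature.Analysis.FluidPDE (IsHardCore isHardCore_empty)
open Literature.Analysis.FunctionSpaces
open Literature.MathematicalPhysics.StatisticalMechanics (window mem_window measurableSet_window window_mono)

variable {ι : Type*} [Fintype ι] (i₀ : ι)


/-! ### Local events -/

section LocalEvents

/-- The windows of the balls `B(0, k)` increase with `k`. [folklore] -/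
theorem window_ball_mono {j k : ℝ} (h : j ≤ k) :
    window (Metric.ball (0 : (EuclideanSpace ℝ ι)) j) ⊆ window (Metric.ball (0 : (EuclideanSpace ℝ ι)) k) :=
  window_mono (Metric.ball_subset_ball h)

/-- A local event over `B(0, j)` is a local event over every larger ball `B(0, k)`. [folklore] -/
theorem preimage_restrict_eq_preimage_restrict_of_le {j k : ℝ} (h : j ≤ k)
    (A' : Set (PointConfig (EuclideanSpace ℝ ι × EuclideanSpace ℝ ι))) :
    PointConfig.restrict (window (Metric.ball (0 : (EuclideanSpace ℝ ι)) j)) ⁻¹' A' =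
      PointConfig.restrict (window (Metric.ball (0 : (EuclideanSpace ℝ ι)) k)) ⁻¹'
        (PointConfig.restrict (window (Metric.ball (0 : (EuclideanSpace ℝ ι)) j)) ⁻¹' A') := by
  ext c
  simp only [mem_preimage, restrict_restrict_of_subset (window_ball_mono h)]

/-- **The local events form a π-system.** [folklore] -/
theorem isPiSystem_localEvents :
    IsPiSystem {A : Set (PointConfig (EuclideanSpace ℝ ι × EuclideanSpace ℝ ι)) | ∃ (k : ℕ) (A' : Set (PointConfig (EuclideanSpace ℝ ι × EuclideanSpace ℝ ι))),
      MeasurableSet A' ∧ A = PointConfig.restrict (window (Metric.ball (0 : (EuclideanSpace ℝ ι)) k)) ⁻¹' A'} := by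
  rintro A ⟨j, A', hA', rfl⟩ B ⟨k, B', hB', rfl⟩ _
  have hwj : MeasurableSet (window (Metric.ball (0 : (EuclideanSpace ℝ ι)) j)) :=
    measurableSet_window Metric.isOpen_ball.measurableSet
  have hwk : MeasurableSet (window (Metric.ball (0 : (EuclideanSpace ℝ ι)) k)) :=
    measurableSet_window Metric.isOpen_ball.measurableSet
  rcases le_total j k with hjk | hkj
  · refine ⟨k, PointConfig.restrict (window (Metric.ball (0 : (EuclideanSpace ℝ ι)) j)) ⁻¹' A' ∩ B',
      (hA'.preimage (PointConfig.measurable_restrict hwj)).inter hB', ?_⟩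
    rw [preimage_inter, ← preimage_restrict_eq_preimage_restrict_of_le (Nat.cast_le.2 hjk)]
  · refine ⟨j, A' ∩ PointConfig.restrict (window (Metric.ball (0 : (EuclideanSpace ℝ ι)) k)) ⁻¹' B',
      hA'.inter (hB'.preimage (PointConfig.measurable_restrict hwk)), ?_⟩
    rw [preimage_inter, ← preimage_restrict_eq_preimage_restrict_of_le (Nat.cast_le.2 hkj)]

/-- Local events are measurable. [folklore] -/
theorem measurableSet_of_mem_localEvents {A : Set (PointConfig (EuclideanSpace ℝ ι × EuclideanSpace ℝ ι))}
    (hA : A ∈ {A : Set (PointConfig (EuclideanSpace ℝ ι × EuclideanSpace ℝ ι)) | ∃ (k : ℕ) (A' : Set (PointConfig (EuclideanSpace ℝ ι × EuclideanSpace ℝ ι))),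
      MeasurableSet A' ∧ A = PointConfig.restrict (window (Metric.ball (0 : (EuclideanSpace ℝ ι)) k)) ⁻¹' A'}) :
    MeasurableSet A := by
  obtain ⟨k, A', hA', rfl⟩ := hA
  exact hA'.preimage (PointConfig.measurable_restrict
    (measurableSet_window Metric.isOpen_ball.measurableSet))

/-- **The local events generate the σ-algebra of configurations**: the count of a measurable `s`
is at least `a` iff the count of some `s ∩ B(0,k) × ℝ³` is, and the latter event is local.
[folklore] -/
theorem generateFrom_localEvents :
    MeasurableSpace.generateFrom {A : Set (PointConfig (EuclideanSpace ℝ ι × EuclideanSpace ℝ ι)) | ∃ (k : ℕ) (A' : Set (PointConfig (EuclideanSpace ℝ ι × EuclideanSpace ℝ ι))),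
      MeasurableSet A' ∧ A = PointConfig.restrict (window (Metric.ball (0 : (EuclideanSpace ℝ ι)) k)) ⁻¹' A'} =
      (PointConfig.instMeasurableSpace : MeasurableSpace (PointConfig (EuclideanSpace ℝ ι × EuclideanSpace ℝ ι))) := by
  set C := {A : Set (PointConfig (EuclideanSpace ℝ ι × EuclideanSpace ℝ ι)) | ∃ (k : ℕ) (A' : Set (PointConfig (EuclideanSpace ℝ ι × EuclideanSpace ℝ ι))),
      MeasurableSet A' ∧ A = PointConfig.restrict (window (Metric.ball (0 : (EuclideanSpace ℝ ι)) k)) ⁻¹' A'}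
    with hC
  apply le_antisymm
  · exact MeasurableSpace.generateFrom_le fun A hA => measurableSet_of_mem_localEvents hA
  · change ⨆ (s : Set (EuclideanSpace ℝ ι × EuclideanSpace ℝ ι)) (_ : MeasurableSet s),
      (⊤ : MeasurableSpace ℕ∞).comap (fun c : PointConfig (EuclideanSpace ℝ ι × EuclideanSpace ℝ ι) => c.count s) ≤ _
    refine iSup₂_le fun s hs => ?_
    rw [← measurable_iff_comap_le]
    set W : ℕ → Set (EuclideanSpace ℝ ι × EuclideanSpace ℝ ι) := fun k => window (Metric.ball (0 : (EuclideanSpace ℝ ι)) k) with hW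
    have hWmono : Monotone W := fun j k hjk => window_ball_mono (Nat.cast_le.2 hjk)
    have hWU : ⋃ k, W k = univ := by
      refine eq_univ_of_forall fun x => mem_iUnion.2 ?_
      obtain ⟨k, hk⟩ := exists_nat_gt ‖x.1‖
      exact ⟨k, by rw [hW, mem_window, mem_ball_zero_iff]; exact hk⟩
    -- the events `{a ≤ N(s ∩ W k)}` are local
    have hG : ∀ (a k : ℕ), MeasurableSet[MeasurableSpace.generateFrom C]
        {c : PointConfig (EuclideanSpace ℝ ι × EuclideanSpace ℝ ι) | (a : ℕ∞) ≤ c.count (s ∩ W k)} := by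
      intro a k
      refine MeasurableSpace.measurableSet_generateFrom ⟨k, {c | (a : ℕ∞) ≤ c.count (s ∩ W k)},
        PointConfig.measurable_count (hs.inter (measurableSet_window
          Metric.isOpen_ball.measurableSet))
          (MeasurableSpace.measurableSet_top : MeasurableSet {n : ℕ∞ | (a : ℕ∞) ≤ n}), ?_⟩
      ext c
      simp only [mem_setOf_eq, mem_preimage, PointConfig.count_restrict]
      rw [show W k ∩ (s ∩ W k) = s ∩ W k by rw [inter_comm, inter_assoc, inter_self]]
    have hG' : ∀ a : ℕ, MeasurableSet[MeasurableSpace.generateFrom C]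
        {c : PointConfig (EuclideanSpace ℝ ι × EuclideanSpace ℝ ι) | (a : ℕ∞) ≤ c.count s} := by
      intro a
      have : {c : PointConfig (EuclideanSpace ℝ ι × EuclideanSpace ℝ ι) | (a : ℕ∞) ≤ c.count s} =
          ⋃ k, {c : PointConfig (EuclideanSpace ℝ ι × EuclideanSpace ℝ ι) | (a : ℕ∞) ≤ c.count (s ∩ W k)} := by
        ext c
        simp only [mem_setOf_eq, mem_iUnion]
        exact c.natCast_le_count_iff_exists s hWmono hWU a
      rw [this]
      exact MeasurableSet.iUnion fun k => hG a k
    refine (@ENat.measurable_iff _ (MeasurableSpace.generateFrom C) _).2 fun a => ?_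
    have : (fun c : PointConfig (EuclideanSpace ℝ ι × EuclideanSpace ℝ ι) => c.count s) ⁻¹' {(a : ℕ∞)} =
        {c : PointConfig (EuclideanSpace ℝ ι × EuclideanSpace ℝ ι) | (a : ℕ∞) ≤ c.count s} \
          {c : PointConfig (EuclideanSpace ℝ ι × EuclideanSpace ℝ ι) | ((a + 1 : ℕ) : ℕ∞) ≤ c.count s} := by
      ext c
      simp only [mem_preimage, mem_singleton_iff, Set.mem_sdiff, mem_setOf_eq, not_le,
        Nat.cast_add, Nat.cast_one]
      constructor
      · intro hc
        rw [hc]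
        exact ⟨le_rfl, ENat.coe_lt_coe.2 (Nat.lt_succ_self a)|>.trans_eq' (by simp)⟩
      · rintro ⟨h1, h2⟩
        exact le_antisymm ((ENat.lt_add_one_iff (ENat.coe_ne_top a)).1 (by simpa using h2)) h1
    rw [this]
    exact (hG' a).diff (hG' (a + 1))

/-- **Two finite measures on configurations agreeing on local events, with the same total mass,
are equal.** [folklore] -/
theorem ext_of_localEvents {μ μ' : Measure (PointConfig (EuclideanSpace ℝ ι × EuclideanSpace ℝ ι))} [IsFiniteMeasure μ]
    (h : ∀ (k : ℕ) (A' : Set (PointConfig (EuclideanSpace ℝ ι × EuclideanSpace ℝ ι))), MeasurableSet A' →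
      μ (PointConfig.restrict (window (Metric.ball (0 : (EuclideanSpace ℝ ι)) k)) ⁻¹' A') =
        μ' (PointConfig.restrict (window (Metric.ball (0 : (EuclideanSpace ℝ ι)) k)) ⁻¹' A'))
    (huniv : μ univ = μ' univ) : μ = μ' := by
  refine ext_of_generate_finite _ generateFrom_localEvents.symm isPiSystem_localEvents ?_ huniv
  rintro A ⟨k, A', hA', rfl⟩
  exact h k A' hA'

end LocalEvents

/-! ### Uniqueness of the DLR state -/

section Unique

variable (ν : Measure (EuclideanSpace ℝ ι × EuclideanSpace ℝ ι)) [IsLocallyFiniteMeasure ν] {σ : ℝ}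

/-- **A mixture of finite-volume Gibbs distributions over hard-core boundary conditions is pinned
by the free boundary condition on local events**: if a probability measure `ρ` carried by
hard-core configurations satisfies the mixture identity `ρ(A) = ∫ γ_{B(0,R)}(η)(A) dρ(η)` for a
local event `A` over `B(0, k)` and `R = k + (d+2)σ` (a DLR state by the DLR equation, or a
finite-volume Gibbs distribution in a larger volume by consistency), then
`|ρ(A) - γ_{B(0,R)}(∅)(A)| ≤ 2 ν(B(0,k) × ℝ³) e^{ν(B(0,k) × ℝ³)} (2κ)^d`, each `γ_{B(0,R)}(η)(A)`
being within that distance of the free value by `abs_hsLocalSpec_toReal_sub_le i₀`.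
[cite: MichelenPerkins2021, §5, proof of Thm 25] -/
theorem abs_measureReal_sub_hsLocalSpec_empty_le_of_mixture (hσ : 0 < σ) (h0 : ∀ x, ν {x} = 0)
    (hm : ∀ t : ℝ, ν {y : EuclideanSpace ℝ ι × EuclideanSpace ℝ ι | y.1 i₀ = t} = 0) {κ : ℝ} (hκ0 : 0 ≤ κ)
    (hκ : ∀ a : (EuclideanSpace ℝ ι), ν (window (Metric.ball a σ)) ≤ ENNReal.ofReal κ)
    (hfin : ∀ R : ℝ, ν (window (Metric.ball (0 : (EuclideanSpace ℝ ι)) R)) ≠ ∞)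
    {ρ : Measure (PointConfig (EuclideanSpace ℝ ι × EuclideanSpace ℝ ι))} [IsProbabilityMeasure ρ] (hρ : ∀ᵐ η ∂ρ, IsHardCore σ η)
    (k d : ℕ) {A' : Set (PointConfig (EuclideanSpace ℝ ι × EuclideanSpace ℝ ι))} (hA' : MeasurableSet A')
    (hmix : ∫⁻ η, hsLocalSpec σ ν (Metric.ball 0 (k + (d + 2) * σ)) η
      (PointConfig.restrict (window (Metric.ball (0 : (EuclideanSpace ℝ ι)) k)) ⁻¹' A') ∂ρ =
      ρ (PointConfig.restrict (window (Metric.ball (0 : (EuclideanSpace ℝ ι)) k)) ⁻¹' A')) :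
    |ρ.real (PointConfig.restrict (window (Metric.ball (0 : (EuclideanSpace ℝ ι)) k)) ⁻¹' A') -
      (hsLocalSpec σ ν (Metric.ball 0 (k + (d + 2) * σ)) ∅
        (PointConfig.restrict (window (Metric.ball (0 : (EuclideanSpace ℝ ι)) k)) ⁻¹' A')).toReal| ≤
      2 * ν.real (window (Metric.ball (0 : (EuclideanSpace ℝ ι)) k)) *
        Real.exp (ν.real (window (Metric.ball (0 : (EuclideanSpace ℝ ι)) k))) * (2 * κ) ^ d := by
  set R : ℝ := k + (d + 2) * σ with hR
  set A : Set (PointConfig (EuclideanSpace ℝ ι × EuclideanSpace ℝ ι)) := PointConfig.restrict (window (Metric.ball (0 : (EuclideanSpace ℝ ι)) k)) ⁻¹' A'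
    with hA
  set ε : ℝ := 2 * ν.real (window (Metric.ball (0 : (EuclideanSpace ℝ ι)) k)) *
    Real.exp (ν.real (window (Metric.ball (0 : (EuclideanSpace ℝ ι)) k))) * (2 * κ) ^ d with hε
  set c : ℝ := (hsLocalSpec σ ν (Metric.ball 0 R) ∅ A).toReal with hc
  have hε0 : 0 ≤ ε := by positivity
  have hc0 : 0 ≤ c := ENNReal.toReal_nonneg
  -- a.s. the boundary condition is hard core, hence within `ε` of the free value
  have hbound : ∀ᵐ η ∂ρ, |(hsLocalSpec σ ν (Metric.ball 0 R) η A).toReal - c| ≤ ε := by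
    filter_upwards [hρ] with η hη
    exact abs_hsLocalSpec_toReal_sub_le i₀ ν hσ h0 hm hκ0 hκ (le_of_eq hR.symm) (hfin R)
      (isHardCore_restrict hη _) (isHardCore_restrict (isHardCore_empty σ) _) hA'
  have hfinγ : ∀ η, hsLocalSpec σ ν (Metric.ball 0 R) η A ≠ ∞ := fun η =>
    ne_top_of_le_ne_top ENNReal.one_ne_top (hsLocalSpec_apply_le_one σ ν _ η A)
  -- upper bound
  have hup : ρ A ≤ ENNReal.ofReal (c + ε) := by
    rw [← hmix, ← mul_one (ENNReal.ofReal (c + ε)), ← measure_univ (μ := ρ), ← lintegral_const]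
    refine lintegral_mono_ae (hbound.mono fun η hη => ?_)
    rw [← ENNReal.ofReal_toReal (hfinγ η)]
    exact ENNReal.ofReal_le_ofReal (by linarith [(abs_sub_le_iff.1 hη).1])
  -- lower bound
  have hlow : ENNReal.ofReal (c - ε) ≤ ρ A := by
    rw [← hmix, ← mul_one (ENNReal.ofReal (c - ε)), ← measure_univ (μ := ρ), ← lintegral_const]
    refine lintegral_mono_ae (hbound.mono fun η hη => ?_)
    rw [← ENNReal.ofReal_toReal (hfinγ η)]
    exact ENNReal.ofReal_le_ofReal (by linarith [(abs_sub_le_iff.1 hη).2])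
  rw [abs_sub_le_iff]
  constructor
  · have h1 : ρ.real A ≤ c + ε := by
      rw [measureReal_def, ← ENNReal.toReal_ofReal (by linarith : 0 ≤ c + ε)]
      exact ENNReal.toReal_mono ENNReal.ofReal_ne_top hup
    linarith
  · have h2 : c - ε ≤ ρ.real A := by
      rw [measureReal_def]
      calc c - ε ≤ max (c - ε) 0 := le_max_left _ _
        _ = (ENNReal.ofReal (c - ε)).toReal := ENNReal.toReal_ofReal'.symm
        _ ≤ (ρ A).toReal := ENNReal.toReal_mono (measure_ne_top ρ A) hlow
    linarith

/-- **A DLR state is pinned by the free boundary condition on local events**: for a solution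
`μ` of the DLR equations, a local event `A` over `B(0, k)` and `R = k + (d+2)σ`,
`|μ(A) - γ_{B(0,R)}(∅)(A)| ≤ 2 ν(B(0,k) × ℝ³) e^{ν(B(0,k) × ℝ³)} (2κ)^d` (the DLR equation is
the mixture identity, and `μ` is carried by hard-core configurations).
[cite: MichelenPerkins2021, §5, proof of Thm 25] -/
theorem IsHsLocalGibbs.abs_measureReal_sub_hsLocalSpec_empty_le (hσ : 0 < σ) (h0 : ∀ x, ν {x} = 0)
    (hm : ∀ t : ℝ, ν {y : EuclideanSpace ℝ ι × EuclideanSpace ℝ ι | y.1 i₀ = t} = 0) {κ : ℝ} (hκ0 : 0 ≤ κ)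
    (hκ : ∀ a : (EuclideanSpace ℝ ι), ν (window (Metric.ball a σ)) ≤ ENNReal.ofReal κ)
    (hfin : ∀ R : ℝ, ν (window (Metric.ball (0 : (EuclideanSpace ℝ ι)) R)) ≠ ∞)
    {μ : Measure (PointConfig (EuclideanSpace ℝ ι × EuclideanSpace ℝ ι))} (hμ : IsHsLocalGibbs σ ν μ)
    (k d : ℕ) {A' : Set (PointConfig (EuclideanSpace ℝ ι × EuclideanSpace ℝ ι))} (hA' : MeasurableSet A') :
    |μ.real (PointConfig.restrict (window (Metric.ball (0 : (EuclideanSpace ℝ ι)) k)) ⁻¹' A') -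
      (hsLocalSpec σ ν (Metric.ball 0 (k + (d + 2) * σ)) ∅
        (PointConfig.restrict (window (Metric.ball (0 : (EuclideanSpace ℝ ι)) k)) ⁻¹' A')).toReal| ≤
      2 * ν.real (window (Metric.ball (0 : (EuclideanSpace ℝ ι)) k)) *
        Real.exp (ν.real (window (Metric.ball (0 : (EuclideanSpace ℝ ι)) k))) * (2 * κ) ^ d := by
  haveI := hμ.isProbabilityMeasure
  have hAm : MeasurableSet (PointConfig.restrict (window (Metric.ball (0 : (EuclideanSpace ℝ ι)) k)) ⁻¹' A' :
      Set (PointConfig (EuclideanSpace ℝ ι × EuclideanSpace ℝ ι))) :=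
    hA'.preimage (PointConfig.measurable_restrict
      (measurableSet_window Metric.isOpen_ball.measurableSet))
  exact abs_measureReal_sub_hsLocalSpec_empty_le_of_mixture i₀ ν hσ h0 hm hκ0 hκ hfin hμ.ae_isHardCore
    k d hA' (hμ.lintegral_hsLocalSpec Metric.isOpen_ball.measurableSet Metric.isBounded_ball hAm)

/-- **Uniqueness of the local Gibbs state of the hard-sphere gas at small activity**
(Michelen–Perkins 2021, Thm 3 / Thm 25, for the hard-sphere gas with a position-dependent
activity and velocity marks, in DLR form and with the crude threshold `2κ < 1`): if the one-particle
intensity `ν` is locally finite, atomless, charges no hyperplane `{y₁ = t}`, gives finite mass to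
the windows of balls and mass `≤ κ` with `2κ < 1` to every ball window `B°_σ(·)`, then the DLR
equations `IsHsLocalGibbs σ ν` have at most one solution: two solutions agree on every local event
(both are within `C_k (2κ)^d` of the same free finite-volume value, for every `d`), and local events
generate. [cite: MichelenPerkins2021, Thm 3 and Thm 25] -/
theorem IsHsLocalGibbs.unique_of_small_activity (hσ : 0 < σ) (h0 : ∀ x, ν {x} = 0)
    (hm : ∀ t : ℝ, ν {y : EuclideanSpace ℝ ι × EuclideanSpace ℝ ι | y.1 i₀ = t} = 0) {κ : ℝ} (hκ0 : 0 ≤ κ)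
    (hκ : ∀ a : (EuclideanSpace ℝ ι), ν (window (Metric.ball a σ)) ≤ ENNReal.ofReal κ) (hκ1 : 2 * κ < 1)
    (hfin : ∀ R : ℝ, ν (window (Metric.ball (0 : (EuclideanSpace ℝ ι)) R)) ≠ ∞)
    {μ μ' : Measure (PointConfig (EuclideanSpace ℝ ι × EuclideanSpace ℝ ι))} (hμ : IsHsLocalGibbs σ ν μ) (hμ' : IsHsLocalGibbs σ ν μ') :
    μ = μ' := by
  haveI := hμ.isProbabilityMeasure
  haveI := hμ'.isProbabilityMeasure
  refine ext_of_localEvents (fun k A' hA' => ?_) (by simp)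
  set A : Set (PointConfig (EuclideanSpace ℝ ι × EuclideanSpace ℝ ι)) := PointConfig.restrict (window (Metric.ball (0 : (EuclideanSpace ℝ ι)) k)) ⁻¹' A'
    with hA
  set C : ℝ := 2 * ν.real (window (Metric.ball (0 : (EuclideanSpace ℝ ι)) k)) *
    Real.exp (ν.real (window (Metric.ball (0 : (EuclideanSpace ℝ ι)) k))) with hC
  have hd : ∀ d : ℕ, |μ.real A - μ'.real A| ≤ 2 * C * (2 * κ) ^ d := fun d => by
    have h1 := hμ.abs_measureReal_sub_hsLocalSpec_empty_le i₀ ν hσ h0 hm hκ0 hκ hfin k d hA'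
    have h2 := hμ'.abs_measureReal_sub_hsLocalSpec_empty_le i₀ ν hσ h0 hm hκ0 hκ hfin k d hA'
    rw [abs_sub_comm] at h2
    calc |μ.real A - μ'.real A| ≤ _ := abs_sub_le _ _ _
      _ ≤ C * (2 * κ) ^ d + C * (2 * κ) ^ d := add_le_add h1 h2
      _ = 2 * C * (2 * κ) ^ d := by ring
  have htend : Tendsto (fun d : ℕ => 2 * C * (2 * κ) ^ d) atTop (𝓝 0) := by
    have h := (tendsto_pow_atTop_nhds_zero_of_lt_one (by positivity : 0 ≤ 2 * κ) hκ1).const_mul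
      (2 * C)
    rwa [mul_zero] at h
  have h0' : |μ.real A - μ'.real A| ≤ 0 := ge_of_tendsto' htend hd
  have heq : μ.real A = μ'.real A := by
    have := abs_nonpos_iff.1 h0'
    linarith
  rw [measureReal_def, measureReal_def] at heq
  exact (ENNReal.toReal_eq_toReal_iff' (measure_ne_top _ _) (measure_ne_top _ _)).1 heq

end Unique

end HardSphereDLR

end Literature.MathematicalPhysics.KineticTheory

end
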